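import Mathlib

/-!
# `HyperbolicToTorus` (stmt-QuantumFields-15827) — negative side: square-complex bookkeeping (chart rigidity, part I)

Support file for crux `stmt-QuantumFields-15827`
(`Summit.QuantumFields.YangMills.Theses.HyperbolicRegulator.HyperbolicToTorus`), extracted from the standing
disprover's work file `Cruxes/HyperbolicToTorus/Disproof.lean` (§3, the VACUITY THREAT); part II is
`Negative/ChartRigidity.lean`. Pure combinatorics of finite square complexes in the verbatim conventions of the
route's inlined `Fam` vocabulary (edges `e ∈ E ⊆ ℕ` with endpoints `σ e, τ e`; oriented edges `ℕ × Bool` with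
start `if b then σ else τ`; squares `q ∈ Q` with boundary `bd q : Fin 4 → ℕ × Bool`). Mathlib only; nothing
posited; no `def`; nothing here asserts a Theses statement.

* `exists_corner_of_edge_at` — a square containing an edge at `y` has `y` as a corner (A2);
* `two_edges_at_corner` — at a corner the two boundary edges meeting there are distinct edges at `y` (A2);
* `card_edges_eq_four_of_saturated` — **core counting lemma**: if four distinct edges at `y` have all their
  squares in a set of at most four squares, then `dg y = 4` (A2, A4: a fifth square cornered at `y` would need
  two distinct further edges at `y`, only one is left);
* `saturated_of_two` — an edge lying in two known distinct squares lies in no other (A3).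
-/

namespace Summit.QuantumFields.YangMills.Theorems.HyperbolicToTorus.Negative

open Finset Function

/-! ### Square-complex bookkeeping: endpoints of oriented edges, corners of squares -/

section Core

variable {E Q : Finset ℕ} {σ τ : ℕ → ℕ} {bd : ℕ → Fin 4 → ℕ × Bool}

/-- The start of an oriented edge is one of its two endpoints. [folklore] -/
theorem st_mem_pair (σ τ : ℕ → ℕ) (e : ℕ × Bool) :
    (if e.2 then σ e.1 else τ e.1) ∈ ({σ e.1, τ e.1} : Finset ℕ) := by
  cases e.2 <;> simp

/-- The end of an oriented edge is one of its two endpoints. [folklore] -/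
theorem en_mem_pair (σ τ : ℕ → ℕ) (e : ℕ × Bool) :
    (if e.2 then τ e.1 else σ e.1) ∈ ({σ e.1, τ e.1} : Finset ℕ) := by
  cases e.2 <;> simp

/-- The two endpoints of an oriented edge are its start and its end. [folklore] -/
theorem pair_eq_st_en (σ τ : ℕ → ℕ) (e : ℕ × Bool) :
    ({σ e.1, τ e.1} : Finset ℕ) = {(if e.2 then σ e.1 else τ e.1), (if e.2 then τ e.1 else σ e.1)} := by
  cases e.2 <;> simp [Finset.pair_comm]

/-- A square whose boundary contains an edge at `y` has `y` as a corner (consecutive boundary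
edges share their endpoint). [folklore] -/
theorem exists_corner_of_edge_at
    (hA2 : ∀ q ∈ Q, (∀ i, (if (bd q i).2 then τ (bd q i).1 else σ (bd q i).1) =
      (if (bd q (i + 1)).2 then σ (bd q (i + 1)).1 else τ (bd q (i + 1)).1)))
    {q : ℕ} (hq : q ∈ Q) {e y : ℕ} (he : ∃ i, (bd q i).1 = e) (hy : σ e = y ∨ τ e = y) :
    ∃ i, (if (bd q i).2 then σ (bd q i).1 else τ (bd q i).1) = y := by
  obtain ⟨i, rfl⟩ := he
  have hmem : y ∈ ({σ (bd q i).1, τ (bd q i).1} : Finset ℕ) := by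
    rcases hy with h | h <;> simp [h]
  rw [pair_eq_st_en σ τ (bd q i), Finset.mem_insert, Finset.mem_singleton] at hmem
  rcases hmem with h | h
  · exact ⟨i, h.symm⟩
  · exact ⟨i + 1, by rw [← hA2 q hq i]; exact h.symm⟩

/-- At a corner `y` of a square, the two boundary edges meeting at `y` are edges at `y` and are
DISTINCT (the four corners are distinct and an edge has two distinct endpoints). [folklore] -/
theorem two_edges_at_corner
    (hA2 : ∀ q ∈ Q, (∀ i, (bd q i).1 ∈ E) ∧
      (∀ i, (if (bd q i).2 then τ (bd q i).1 else σ (bd q i).1) =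
        (if (bd q (i + 1)).2 then σ (bd q (i + 1)).1 else τ (bd q (i + 1)).1)) ∧
      Function.Injective (fun i => if (bd q i).2 then σ (bd q i).1 else τ (bd q i).1))
    {q : ℕ} (hq : q ∈ Q) {y : ℕ} {i : Fin 4}
    (hi : (if (bd q i).2 then σ (bd q i).1 else τ (bd q i).1) = y) :
    (σ (bd q i).1 = y ∨ τ (bd q i).1 = y) ∧
    (σ (bd q (i + 3)).1 = y ∨ τ (bd q (i + 3)).1 = y) ∧
    (bd q i).1 ≠ (bd q (i + 3)).1 := by
  obtain ⟨-, hcons, hinj⟩ := hA2 q hq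
  have fin4_add_three_add_one : ∀ i : Fin 4, i + 3 + 1 = i := by decide
  have fin4_add_three_ne_add_one : ∀ i : Fin 4, i + 3 ≠ i + 1 := by decide
  have fin4_add_three_ne : ∀ i : Fin 4, i + 3 ≠ i := by decide
  refine ⟨?_, ?_, ?_⟩
  · revert hi
    cases (bd q i).2 <;> simp +contextual
  · have h3 := hcons (i + 3)
    rw [fin4_add_three_add_one, hi] at h3
    revert h3
    cases (bd q (i + 3)).2 <;> simp +contextual [eq_comm]
  · intro heq
    have h3 := hcons (i + 3)
    rw [fin4_add_three_add_one] at h3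
    -- compare the orientation bits
    by_cases hb : (bd q (i + 3)).2 = (bd q i).2
    · -- same edge id and same bit: the corner map is not injective
      have : (fun i => if (bd q i).2 then σ (bd q i).1 else τ (bd q i).1) (i + 3) =
          (fun i => if (bd q i).2 then σ (bd q i).1 else τ (bd q i).1) i := by
        simp only [hb, ← heq]
      exact fin4_add_three_ne i (hinj this)
    · -- opposite bits: the start of edge `i+3` is the end of edge `i`, i.e. corner `i+1`
      have hc := hcons i
      have : (fun i => if (bd q i).2 then σ (bd q i).1 else τ (bd q i).1) (i + 3) =
          (fun i => if (bd q i).2 then σ (bd q i).1 else τ (bd q i).1) (i + 1) := by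
        simp only
        rw [← hc, ← heq]
        revert hb
        cases (bd q (i + 3)).2 <;> cases (bd q i).2 <;> simp
      exact fin4_add_three_ne_add_one i (hinj this)

/-- In a two-element finset, any member is one of two given distinct members. [folklore] -/
theorem eq_or_eq_of_card_eq_two {s : Finset ℕ} (hs : s.card = 2) {a b c : ℕ} (ha : a ∈ s)
    (hb : b ∈ s) (hab : a ≠ b) (hc : c ∈ s) : c = a ∨ c = b := by
  obtain ⟨x, z, hxz, rfl⟩ := Finset.card_eq_two.1 hs
  simp only [Finset.mem_insert, Finset.mem_singleton] at ha hb hc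
  rcases ha with rfl | rfl <;> rcases hb with rfl | rfl <;> tauto

/-- **Core counting lemma.** At a vertex `y` of a square complex in which every edge lies in exactly
the squares recorded by `Q` and the number of squares cornered at `y` equals the number `dg y ∈ {4,5}`
of edges at `y`: if four distinct edges at `y` (the finset `Ch`) have ALL their squares inside a
finset `Sq4` of at most four squares, then `dg y = 4`. (A fifth square cornered at `y` would need two
distinct boundary edges at `y` outside `Ch`, but only one edge at `y` is left.) [folklore] -/
theorem card_edges_eq_four_of_saturated
    (hA2 : ∀ q ∈ Q, (∀ i, (bd q i).1 ∈ E) ∧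
      (∀ i, (if (bd q i).2 then τ (bd q i).1 else σ (bd q i).1) =
        (if (bd q (i + 1)).2 then σ (bd q (i + 1)).1 else τ (bd q (i + 1)).1)) ∧
      Function.Injective (fun i => if (bd q i).2 then σ (bd q i).1 else τ (bd q i).1))
    (y : ℕ) (Ch Sq4 : Finset ℕ)
    (hdeg : (E.filter fun e => σ e = y ∨ τ e = y).card = 4 ∨
      (E.filter fun e => σ e = y ∨ τ e = y).card = 5)
    (hcount : (Q.filter fun q => ∃ i, (if (bd q i).2 then σ (bd q i).1 else τ (bd q i).1) = y).card =
      (E.filter fun e => σ e = y ∨ τ e = y).card)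
    (hCh : Ch.card = 4) (hChD : Ch ⊆ E.filter fun e => σ e = y ∨ τ e = y) (hSq4 : Sq4.card ≤ 4)
    (hsat : ∀ e ∈ Ch, ∀ q ∈ Q, (∃ i, (bd q i).1 = e) → q ∈ Sq4) :
    (E.filter fun e => σ e = y ∨ τ e = y).card = 4 := by
  rcases hdeg with h4 | h5
  · exact h4
  exfalso
  set D := E.filter fun e => σ e = y ∨ τ e = y with hD
  have hlt : Sq4.card <
      (Q.filter fun q => ∃ i, (if (bd q i).2 then σ (bd q i).1 else τ (bd q i).1) = y).card := by
    omega
  obtain ⟨q5, hq5, hq5n⟩ := Finset.exists_mem_notMem_of_card_lt_card hlt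
  simp only [Finset.mem_filter] at hq5
  obtain ⟨hq5Q, i, hi⟩ := hq5
  obtain ⟨hg, hg', hne⟩ := two_edges_at_corner hA2 hq5Q hi
  have hgD : (bd q5 i).1 ∈ D := Finset.mem_filter.2 ⟨(hA2 q5 hq5Q).1 i, hg⟩
  have hg'D : (bd q5 (i + 3)).1 ∈ D := Finset.mem_filter.2 ⟨(hA2 q5 hq5Q).1 (i + 3), hg'⟩
  have hgCh : (bd q5 i).1 ∉ Ch := fun hmem => hq5n (hsat _ hmem q5 hq5Q ⟨i, rfl⟩)
  have hg'Ch : (bd q5 (i + 3)).1 ∉ Ch := fun hmem => hq5n (hsat _ hmem q5 hq5Q ⟨i + 3, rfl⟩)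
  have hsd : (D \ Ch).card ≤ 1 := by
    rw [Finset.card_sdiff_of_subset hChD]
    omega
  exact hne (Finset.card_le_one.1 hsd _ (Finset.mem_sdiff.2 ⟨hgD, hgCh⟩) _
    (Finset.mem_sdiff.2 ⟨hg'D, hg'Ch⟩))

/-- If the square-set of an edge has exactly two elements and contains the distinct squares `q₁, q₂`,
every square containing the edge is `q₁` or `q₂`. [folklore] -/
theorem saturated_of_two
    (hA3 : ∀ e ∈ E, (Q.filter fun q => ∃ i, (bd q i).1 = e).card = 2)
    {e : ℕ} (he : e ∈ E) {q₁ q₂ : ℕ} (h₁ : q₁ ∈ Q) (h₁e : ∃ i, (bd q₁ i).1 = e)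
    (h₂ : q₂ ∈ Q) (h₂e : ∃ i, (bd q₂ i).1 = e) (hne : q₁ ≠ q₂)
    {q : ℕ} (hq : q ∈ Q) (hqe : ∃ i, (bd q i).1 = e) : q = q₁ ∨ q = q₂ :=
  eq_or_eq_of_card_eq_two (hA3 e he) (Finset.mem_filter.2 ⟨h₁, h₁e⟩)
    (Finset.mem_filter.2 ⟨h₂, h₂e⟩) hne (Finset.mem_filter.2 ⟨hq, hqe⟩)

end Core

end Summit.QuantumFields.YangMills.Theorems.HyperbolicToTorus.Negative
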